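import Mathlib
import Literature.NumberTheory.Transcendental.KZCalculus

/-!
# `TateLifting` (stmt-KontsevichZagierPeriods-9129), line `Sketch` — stub `stub_arcsinBandValue`

THE AREA OF THE ARCSINE BAND (stub 67, the body of `ArcsinBandValue`). Wave c9-4b turns the
representation `[F₁, y⁻²]` over the standard fundamental domain of `SL₂(ℤ)` into the integrand-`1`
representation over the bounded conic band

  `G = {(x, t) | x² ≤ 1/4, 0 ≤ t, t² (1 − x²) ≤ 1} = {|x| ≤ 1/2, 0 ≤ t ≤ 1/√(1 − x²)}`

by the inversion `t = 1/y` (stub 66). This file computes the number `[G, 1]` represents: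

  `∬_G dx dt = ∫_{-1/2}^{1/2} dx/√(1 − x²) = arcsin (1/2) − arcsin (−1/2) = π/6 + π/6 = π/3`.

Steps: the value of an integrand-`1` representation is the volume of its domain
(`setIntegral_congr_fun`, `setIntegral_const`); transport `(Fin 2 → ℝ) ≃ᵐ ℝ × ℝ` along the
volume-preserving `MeasurableEquiv.finTwoArrow` and slice by Tonelli
(`MeasureTheory.Measure.prod_apply`): the fibre of `G` over `x ∈ [-1/2, 1/2]` is the interval
`[0, 1/√(1 − x²)]`, empty otherwise (`ArcsinBand.mem_band_iff`); the resulting integral of the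
continuous function `1/√(1 − x²)` over `[-1/2, 1/2]` is evaluated by the fundamental theorem of
calculus with primitive `arcsin` (`Real.hasDerivAt_arcsin`) and `sin (π/6) = 1/2`
(`ArcsinBand.integral_invSqrt`).

References: M. Kontsevich, D. Zagier, *Periods* (2001), §1.1–§1.2.
-/

noncomputable section

open MeasureTheory Set
open Literature.NumberTheory.Transcendental

namespace Summit.KontsevichZagierPeriods.InverseLandau

namespace ArcsinBand

/-- `x² ≤ 1/4 ↔ x ∈ [-1/2, 1/2]`. [folklore] -/
theorem sq_le_quarter_iff (x : ℝ) : x ^ 2 ≤ 1 / 4 ↔ x ∈ Icc (-(1 / 2) : ℝ) (1 / 2) := by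
  rw [mem_Icc]
  constructor
  · intro h
    constructor <;> nlinarith
  · rintro ⟨h₁, h₂⟩
    nlinarith

/-- The fibre of the band over `x` with `x² ≤ 1/4` is `[0, 1/√(1 − x²)]`:
`0 ≤ t ∧ t² (1 − x²) ≤ 1 ↔ 0 ≤ t ≤ 1/√(1 − x²)` (as `1 − x² > 0`). [folklore] -/
theorem fibre_iff {x t : ℝ} (hx : x ^ 2 ≤ 1 / 4) :
    (0 ≤ t ∧ t ^ 2 * (1 - x ^ 2) ≤ 1) ↔ t ∈ Icc 0 (1 / √(1 - x ^ 2)) := by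
  have hc : 0 < 1 - x ^ 2 := by linarith
  rw [mem_Icc]
  refine and_congr_right fun ht => ?_
  rw [le_div_iff₀ (Real.sqrt_pos.2 hc), ← sq_le_one_iff₀ (mul_nonneg ht (Real.sqrt_nonneg (1 - x ^ 2))),
    mul_pow, Real.sq_sqrt hc.le]

/-- Membership in the band, fibrewise over the first coordinate. [folklore] -/
theorem mem_band_iff (x t : ℝ) :
    (x ^ 2 ≤ 1 / 4 ∧ 0 ≤ t ∧ t ^ 2 * (1 - x ^ 2) ≤ 1) ↔
      x ∈ Icc (-(1 / 2) : ℝ) (1 / 2) ∧ t ∈ Icc 0 (1 / √(1 - x ^ 2)) := by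
  constructor
  · rintro ⟨hx, ht⟩
    exact ⟨(sq_le_quarter_iff x).1 hx, (fibre_iff hx).1 ht⟩
  · rintro ⟨hx, ht⟩
    have hx' := (sq_le_quarter_iff x).2 hx
    exact ⟨hx', (fibre_iff hx').2 ht⟩

/-- `x ↦ 1/√(1 − x²)` is continuous on `[-1/2, 1/2]` (the square root does not vanish there).
[folklore] -/
theorem continuousOn_invSqrt :
    ContinuousOn (fun x : ℝ => 1 / √(1 - x ^ 2)) (Icc (-(1 / 2) : ℝ) (1 / 2)) := by
  refine ContinuousOn.div₀ continuousOn_const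
    (by fun_prop : Continuous fun x : ℝ => √(1 - x ^ 2)).continuousOn fun x hx => ?_
  have hx' := (sq_le_quarter_iff x).2 hx
  exact (Real.sqrt_pos.2 (by linarith)).ne'

/-- `∫_{[-1/2, 1/2]} dx/√(1 − x²) = arcsin (1/2) − arcsin (−1/2) = π/3` (fundamental theorem of
calculus with primitive `arcsin`, and `sin (π/6) = 1/2`). [folklore] -/
theorem integral_invSqrt :
    ∫ x in Icc (-(1 / 2) : ℝ) (1 / 2), 1 / √(1 - x ^ 2) = Real.pi / 3 := by
  have hle : (-(1 / 2) : ℝ) ≤ 1 / 2 := by norm_num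
  have hderiv : ∀ x ∈ uIcc (-(1 / 2) : ℝ) (1 / 2),
      HasDerivAt Real.arcsin (1 / √(1 - x ^ 2)) x := by
    intro x hx
    rw [uIcc_of_le hle] at hx
    exact Real.hasDerivAt_arcsin (ne_of_gt (by linarith [hx.1])) (ne_of_lt (by linarith [hx.2]))
  have hint : IntervalIntegrable (fun x : ℝ => 1 / √(1 - x ^ 2)) volume (-(1 / 2)) (1 / 2) := by
    refine ContinuousOn.intervalIntegrable ?_
    rw [uIcc_of_le hle]
    exact continuousOn_invSqrt
  have h6 : Real.arcsin (1 / 2) = Real.pi / 6 := by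
    rw [← Real.sin_pi_div_six]
    exact Real.arcsin_sin (by linarith [Real.pi_pos]) (by linarith [Real.pi_pos])
  rw [integral_Icc_eq_integral_Ioc, ← intervalIntegral.integral_of_le hle,
    intervalIntegral.integral_eq_sub_of_hasDerivAt hderiv hint, Real.arcsin_neg, h6]
  ring

/-- **Area of the arcsine band**: `vol {z | z₀² ≤ 1/4, 0 ≤ z₁, z₁² (1 − z₀²) ≤ 1} = π/3` — Tonelli
along the second coordinate after transport to `ℝ × ℝ` (`MeasurableEquiv.finTwoArrow`,
`MeasureTheory.Measure.prod_apply`), the fibre over `x ∈ [-1/2, 1/2]` having length `1/√(1 − x²)`,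
then `integral_invSqrt`. [folklore] -/
theorem volume_band {S : Set (Fin 2 → ℝ)} (hSm : MeasurableSet S)
    (hS : S = {z | z 0 ^ 2 ≤ 1 / 4 ∧ 0 ≤ z 1 ∧ z 1 ^ 2 * (1 - z 0 ^ 2) ≤ 1}) :
    volume S = ENNReal.ofReal (Real.pi / 3) := by
  set e : (Fin 2 → ℝ) ≃ᵐ ℝ × ℝ := MeasurableEquiv.finTwoArrow with he_def
  have he : MeasurePreserving e.symm (volume.prod volume) volume :=
    (volume_preserving_finTwoArrow ℝ).symm
  have hmem : ∀ x t : ℝ, e.symm (x, t) ∈ S ↔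
      x ∈ Icc (-(1 / 2) : ℝ) (1 / 2) ∧ t ∈ Icc 0 (1 / √(1 - x ^ 2)) := by
    intro x t
    rw [← mem_band_iff x t, hS, he_def]
    simp only [MeasurableEquiv.finTwoArrow_symm_apply, Fin.cons_zero, Fin.cons_one, mem_setOf_eq]
  have hfib : (fun x : ℝ => volume (Prod.mk x ⁻¹' (e.symm ⁻¹' S))) =
      (Icc (-(1 / 2) : ℝ) (1 / 2)).indicator fun x => ENNReal.ofReal (1 / √(1 - x ^ 2)) := by
    funext x
    by_cases hx : x ∈ Icc (-(1 / 2) : ℝ) (1 / 2)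
    · rw [indicator_of_mem hx]
      have h : Prod.mk x ⁻¹' (e.symm ⁻¹' S) = Icc 0 (1 / √(1 - x ^ 2)) := by
        ext t
        simp only [mem_preimage, hmem, hx, true_and]
      rw [h, Real.volume_Icc, sub_zero]
    · rw [indicator_of_notMem hx]
      have h : Prod.mk x ⁻¹' (e.symm ⁻¹' S) = ∅ := by
        ext t
        simp only [mem_preimage, hmem, hx, false_and, mem_empty_iff_false]
      rw [h, measure_empty]
  rw [← he.measure_preimage_equiv S, Measure.prod_apply (e.symm.measurable hSm), hfib,
    lintegral_indicator measurableSet_Icc,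
    ← ofReal_integral_eq_lintegral_ofReal (μ := volume.restrict (Icc (-(1 / 2) : ℝ) (1 / 2)))
      continuousOn_invSqrt.integrableOn_Icc
      (Filter.Eventually.of_forall fun x => div_nonneg zero_le_one (Real.sqrt_nonneg _)),
    integral_invSqrt]

end ArcsinBand

/-- **The arcsine band has area `π/3`.** For every integral representation `g` of dimension `2`
whose domain is the closed conic band `{(x, t) | x² ≤ 1/4, 0 ≤ t, t² (1 − x²) ≤ 1}`
(`= {|x| ≤ 1/2, 0 ≤ t ≤ 1/√(1 − x²)}`, the image of the fundamental domain of `SL₂(ℤ)` under the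
inversion `t = 1/y`) and whose integrand is `1` on that domain, the represented number is
`∫_{-1/2}^{1/2} dx/√(1 − x²) = arcsin (1/2) − arcsin (−1/2) = π/3`.
[cite: KontsevichZagier2001, §1.2] -/
theorem tateLifting_arcsinBandValue :
    ∀ (g : KZ.IntegralRep 2), g.domain = {z | z 0 ^ 2 ≤ 1 / 4 ∧ 0 ≤ z 1 ∧ z 1 ^ 2 * (1 - z 0 ^ 2) ≤ 1} →
    (∀ z ∈ g.domain, g.integrand z = 1) → g.value = Real.pi / 3 := by
  intro g hdom hgi
  -- `g.value = ∫_{g.domain} 1 = (vol g.domain).toReal = (ofReal (π/3)).toReal = π/3`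
  rw [KZ.IntegralRep.value, setIntegral_congr_fun (KZ.IntegralRep.measurableSet_domain_holds g) hgi,
    setIntegral_const, smul_eq_mul, mul_one, measureReal_def,
    ArcsinBand.volume_band (KZ.IntegralRep.measurableSet_domain_holds g) hdom,
    ENNReal.toReal_ofReal (by positivity)]

end Summit.KontsevichZagierPeriods.InverseLandau
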